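import Literature.NumberTheory.EllipticCurves.CaiLiZhai2019.TwoPartBSDQuadraticTwists
import HarnessLib

/-!
# Zhai 2021, *The Birch–Swinnerton-Dyer exact formula for quadratic twists of elliptic curves*: the set `𝒮`, Thm. 1.1 (= Thm. 4.2), Thm. 1.3 and Thm. 5.2 AS PRINTED

HONEST FRAMING (cell `b2b-bsdres`, sub-lane `bsd-p2`, run/shared/lean/b2b/bsd-rank1-residual/p2/;
literature typer 1, mandate (iv); lead decision I2-8: "Zh21 decls = F5"): PUBLISHED theorems
vendored as named `Prop`s (nothing asserted, nothing discharged; D-0014), every printed hypothesis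
a binder, locators into the held text. EVIDENCE of what print says at `p = 2`: ANALYTIC-RANK-ZERO
statements — a `2`-adic LOWER BOUND for `L(E^{(M)},1)/c_∞(E^{(M)})` by Tamagawa parities and the
Manin constant, an exact valuation `r − 1` for twists by primes of `𝒮`, and a non-vanishing
infinitude. (The paper's Conjecture 1.2 — infinitely many `r`-prime-factor twists with
`L(E^{(M)},1) ≠ 0` for every `E` — is a CONJECTURE and is not vendored.) Nothing booked; no mark
moved.

Source. S. Zhai, *The Birch–Swinnerton-Dyer exact formula for quadratic twists of elliptic
curves*, arXiv:2102.11798 (2021), Pure Appl. Math. Q. (2025) [Zhai2021BSDExactFormulaTwists]. Text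
read: the held LaTeX-derived text `paper:arxiv-2102.11798` (3000-character chunks; locators =
`chunk:line`; §1 = chunks p0003–p0004, Thm. 4.2 = chunk p0009, Thm. 5.2 = chunk p0010).

## The printed statements (verbatim)

* Conventions (p0003 L3): "We take any global minimal Weierstrass equation for `E`, and write `Δ_E`
  for its discriminant, `ω_E` for its Néron differential, and `Ω_E⁺` for the least positive real
  period of `ω_E` … `L(E, 1)/Ω_E⁺` is a rational number. Define `c_∞(E) = δ_E Ω_E⁺`, where
  `δ_E = 1` or `2` is the number of connected components of `E(ℝ)`. For each finite prime `ℓ`, let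
  `c_ℓ = [E(ℚ_ℓ) : E₀(ℚ_ℓ)]`". (p0003 L11): "`M` will always denote a square free positive or
  negative integer such that `M ≡ 1 mod 4` with `M ≠ 1`, and we shall write `E^{(M)}` for the twist
  of `E` by the extension `ℚ(√M)/ℚ`. For any odd prime `q ∣ M`, we define
  `t_E(M) := ∑_{q ∣ M} t(q)`, where `t(q) = 1` if `2 ∣ c_q(E^{(M)})`; `0` if `2 ∤ c_q(E^{(M)})`."
  (p0003 L23): "`E` is said to be optimal if the map from the modular curve `X₀(C)` to `E` does not
  factor through any other elliptic curve defined over `ℚ`."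
* **Theorem 1.1** (p0003 L25–L32): "Let `E` be any optimal elliptic curve over `ℚ` having conductor
  `C`. Then, for all square free integers `M ≡ 1 mod 4` with `(M, C) = 1` such that
  `L(E^{(M)}, 1) ≠ 0`, we have `ord₂(L(E^{(M)},1)/c_∞(E^{(M)})) ≥ t_E(M) − 1 − ord₂(ν_E)`, where
  `ν_E` is the Manin constant of `E`." **Theorem 4.2** (p0009 L58–L63) is the same statement for
  "`M = ε q₁ q₂ ⋯ q_r` a product of `r` odd distinct primes with `(M, C) = 1`, where the sign
  `ε = ±1` is chosen so that `M ≡ 1 mod 4`", without the non-vanishing proviso.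
* `𝒮` (p0003 L41–L51): "If `q` is any prime of good reduction for `E`, we write `a_q` … so that
  `|E(𝔽_q)| = 1 + q − a_q` … Assume `E(ℚ)[2] ≤ ℤ/2ℤ`, we define …
  `𝒮 = {q ≡ 1,3 mod 4 | ord₂(|E(𝔽_q)|) = ord₂(|E(ℚ)[2]|)}` if `Δ_E < 0`;
  `{q ≡ 1 mod 4 | ord₂(|E(𝔽_q)|) = ord₂(|E(ℚ)[2]|)}` if `Δ_E > 0`."
* **Theorem 1.3** (p0004 L4–L11): "Let `E` be an optimal elliptic curve over `ℚ` such that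
  • `E(ℚ)[2] ≤ ℤ/2ℤ`; • `ord₂(L(E,1)/c_∞(E)) = −ord₂(|E(ℚ)[2]| · ν_E)`. If `𝒮` is infinite, then for
  any positive integer `r`, there are infinitely many square-free integers `M`, having exactly `r`
  prime factors in `𝒮`, such that `L(E^{(M)}, 1) ≠ 0`."
* **Theorem 5.2** (p0010 L80–L97): "Let `E` be an optimal elliptic curve over `ℚ` with conductor
  `C`. Assume that • `Δ_E < 0`; • `E(ℚ)[2] ≅ ℤ/2ℤ`; • `E` has odd Manin constant;
  • `ord₂(L(E,1)/c_∞(E)) = −1`. Let `M = ε q₁ q₂ ⋯ q_r` be a product of `r` distinct primes in `𝒮`,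
  where the sign `ε = ±1` is chosen so that `M ≡ 1 mod 4`. Then `L(E^{(M)},1) ≠ 0`, and we have
  `ord₂(L(E^{(M)},1)/c_∞(E^{(M)})) = r − 1`. In particular, `E^{(M)}(ℚ)` and `Ш(E^{(M)})` are both
  finite."

## The `p = 2` flag of this file

Natively AT 2, ANALYTIC RANK ZERO only (`L(E^{(M)},1) ≠ 0`); no parity-of-`p` / image /
reduction-type exclusion at `2`. Restricting hypotheses: `E` optimal; `M ≡ 1 (mod 4)` square-free,
`M ≠ 1`, `(M, C) = 1` (so `2 ∤ M` and the twist is unramified at `2`); Thm. 5.2 additionally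
`Δ_E < 0`, `E(ℚ)[2] ≅ ℤ/2ℤ`, odd Manin constant, `ord₂(L(E,1)/c_∞(E)) = −1`, primes in `𝒮`;
Thm. 1.3 assumes `𝒮` infinite. No rank-one statement in this paper (its rank-one sequel is
Shu–Zhai 2021, `ShuZhai2021/GeneralizedBirchLemma.lean`).

## Transcription (tree dictionary)

* `E` optimal of conductor `C` = a globally minimal `W`, `C = W.conductorNorm ℤ`, with a datum
  `Dt : ModularParametrizationData W C` satisfying the LATTICE EQUALITY `Λ_E ⊆ ν Λ_f` (with the
  structure field `ν Λ_f ⊆ Λ_E`; the rendering of `X₀(C)`-optimality of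
  `ManinConstantSemistablePrimewise` / `CaiLiZhai2019`); `ν_E = Dt.c` (an integer; `ord₂(ν_E)` =
  `padicValInt 2 Dt.c`), "odd Manin constant" = `¬ 2 ∣ Dt.c`.
* `c_∞(E) = δ_E Ω_E⁺ = ∫_{E(ℝ)}|ω_E|` = `realPeriodRat` of a globally minimal model; `L(·,1)` =
  `entireLFunction · 1`; "`ord₂(L/c_∞) ≥ b`" = `L(·,1) = x · c_∞` for a rational `x` with
  `ord₂ x ≥ b` (rationality is part of the printed conventions, p0003 L3).
* `E^{(M)}` = any globally minimal model `WM` of the tree's `quadraticTwist W M`; `c_q(E^{(M)})` =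
  `localTamagawaNumber` of `WM / ℚ_q` (`Tamagawa.lean`, `ℤ_[q]`-minimal model inside);
  `t_E(M)` = `#{q ∣ M prime : 2 ∣ c_q(E^{(M)})}` (`tCount`).
* `|E(𝔽_q)|` at a good prime `q` = `reductionPointCount W q`; `|E(ℚ)[2]|` =
  `Nat.card {P // 2 • P = 0}`; "`E(ℚ)[2] ≤ ℤ/2ℤ`" = that cardinality is `≤ 2`; `𝒮` = `InS`
  (odd primes of good reduction with the printed `ord₂` condition, and `q ≡ 1 (mod 4)` when
  `Δ_E > 0`; `Δ` of the globally minimal `W`, its sign is model-independent).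
* "`M = ε q₁ ⋯ q_r`, `ε` chosen so that `M ≡ 1 (mod 4)`" = `M` square-free, `M % 4 = 1`, with prime
  factor set `Q` of size `r`; "`E^{(M)}(ℚ)` finite" = `Finite WM.toAffine.Point`.
No `_holds` expected (modular symbols, integrality at `2`, induction on `r`).

## References
* [Zhai2021BSDExactFormulaTwists] arXiv:2102.11798: §1 (chunks p0003–p0004) conventions, Thm. 1.1,
  Conj. 1.2 (not vendored), `𝒮`, Thm. 1.3; §3.2 (chunk p0007 L61–L63) `c_∞`, `c_f = c_∞/ν_E`;
  Thm. 4.2 (chunk p0009 L58–L63); Thm. 5.2 (chunk p0010 L80–L97).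
* [CaiLiZhai2019] (tree file `CaiLiZhai2019/TwoPartBSDQuadraticTwists.lean`: the optimality
  rendering and the twist-model pattern).
-/

noncomputable section

open scoped Classical MatrixGroups ModularForm

open CongruenceSubgroup NumberField WeierstrassCurve Literature.NumberTheory.EllipticCurves
  Literature.NumberTheory.EllipticCurves.ModularForms
  Literature.NumberTheory.EllipticCurves.CaiLiZhai2019

namespace Literature.NumberTheory.EllipticCurves.Zhai2021

/-! ### §1. Vocabulary (definitions with bodies; nothing asserted) -/

/-- "`E` is optimal" (the map `X₀(C) → E` does not factor through another elliptic curve over `ℚ`)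
for a globally minimal `W` with parametrisation datum `Dt`: the lattice inclusion `Λ_E ⊆ ν Λ_f`
(with the structure field `ν Λ_f ⊆ Λ_E`: `Λ_E = ν_E Λ_f`), the tree's rendering of
`X₀(C)`-optimality. [cite: Zhai2021BSDExactFormulaTwists, §1 (chunk p0003 L23)] -/
def IsOptimalDatum (W : WeierstrassCurve ℚ) {N : ℕ} [NeZero N]
    (Dt : ModularParametrizationData W N) : Prop :=
  ∀ z ∈ Dt.L.lattice, ∃ w ∈ periodLattice Dt.f, z = Dt.c * w

/-- `t_E(M) = #{q ∣ M prime : 2 ∣ c_q(E^{(M)})}` for a model `WM` of `E^{(M)}` (`c_q` = the local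
Tamagawa number of `WM / ℚ_q`, independent of the model).
[cite: Zhai2021BSDExactFormulaTwists, §1 (chunk p0003 L11–L21)] -/
def tCount (WM : WeierstrassCurve ℚ) (M : ℤ) : ℕ :=
  (M.natAbs.primeFactors.filter fun q =>
    ∀ [Fact q.Prime], 2 ∣ (WM.baseChange ℚ_[q]).localTamagawaNumber ℤ_[q]).card

/-- The set `𝒮` of twisting primes (for `E(ℚ)[2] ≤ ℤ/2ℤ`), on a globally minimal `W` of conductor
`C`: odd primes `q ∤ C` (good reduction) with `ord₂ |E(𝔽_q)| = ord₂ |E(ℚ)[2]|`, and `q ≡ 1 (mod 4)`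
when `Δ_E > 0` (both residues `1, 3 (mod 4)` allowed when `Δ_E < 0`).
[cite: Zhai2021BSDExactFormulaTwists, §1 display (S) (chunk p0003 L41–L51)] -/
def InS (W : WeierstrassCurve ℚ) [W.IsGloballyMinimal] (q : ℕ) : Prop :=
  q.Prime ∧ q ≠ 2 ∧ ¬ q ∣ W.conductorNorm ℤ ∧
    padicValNat 2 (W.reductionPointCount q) =
      padicValNat 2 (Nat.card {P : W.toAffine.Point // (2 : ℕ) • P = 0}) ∧
    (0 < W.Δ → q % 4 = 1)

/-! ### §2. The printed theorems (named facts; nothing asserted) -/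

/-- **Zhai 2021, Theorem 1.1 (= Theorem 4.2)** (verbatim in the module docstring). `E/ℚ` optimal of
conductor `C` (globally minimal `W`, datum `Dt` with the lattice equality, Manin constant
`ν_E = Dt.c`); `M` square-free, `M ≡ 1 (mod 4)`, `M ≠ 1`, `(M, C) = 1`; `WM` a globally minimal
model of `E^{(M)}` with `L(E^{(M)},1) ≠ 0`. Then `L(E^{(M)},1)/c_∞(E^{(M)})` is a rational number of
`2`-adic order `≥ t_E(M) − 1 − ord₂(ν_E)`. AT 2, analytic rank ZERO. No `_holds` expected.
[cite: Zhai2021BSDExactFormulaTwists, Thm. 1.1 (arXiv:2102.11798 chunk p0003 L25–L32) = Thm. 4.2 (chunk p0009 L58–L63)] -/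
def thm11_twoAdic_lower_bound : Prop :=
  ∀ (W : WeierstrassCurve ℚ) [W.IsElliptic] [W.IsGloballyMinimal] [NeZero (W.conductorNorm ℤ)]
    (Dt : ModularParametrizationData W (W.conductorNorm ℤ)), IsOptimalDatum W Dt →
    ∀ (M : ℤ), Squarefree M → M % 4 = 1 → M ≠ 1 → Int.gcd M (W.conductorNorm ℤ) = 1 →
    ∀ (WM : WeierstrassCurve ℚ) [WM.IsElliptic] [WM.IsGloballyMinimal],
      (∃ C : VariableChange ℚ, C • W.quadraticTwist (M : ℚ) = WM) →
      WM.entireLFunction 1 ≠ 0 →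
        ∃ x : ℚ, WM.entireLFunction 1 = (x : ℂ) * (WM.realPeriodRat : ℂ) ∧
          (tCount WM M : ℤ) - 1 - padicValInt 2 Dt.c ≤ padicValRat 2 x

/-- **Zhai 2021, Theorem 1.3** (verbatim in the module docstring). `E/ℚ` optimal (globally minimal
`W`, datum `Dt` with the lattice equality) with `#E(ℚ)[2] ≤ 2` and
`ord₂(L(E,1)/c_∞(E)) = −ord₂(#E(ℚ)[2] · ν_E)`; if `𝒮` is infinite then for every `r ≥ 1` there are
infinitely many square-free `M` with exactly `r` prime factors, all in `𝒮`, such that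
`L(E^{(M)},1) ≠ 0` (stated on every globally minimal model of the twist). AT 2, analytic rank ZERO.
No `_holds` expected. The rational `x = L(E,1)/c_∞(E)` carries `x ≠ 0` explicitly: the printed
`ord₂` equality presupposes `L(E,1) ≠ 0` (`ord₂ 0 = +∞`), while Mathlib's `padicValRat 2 0 = 0` would
otherwise let `x = 0` satisfy the binder when `#E(ℚ)[2] = 1` and `ν_E` is odd (p2-ref GEN 7 nit
`zhai21-thm13-junk-zero`; statement otherwise unchanged).
[cite: Zhai2021BSDExactFormulaTwists, Thm. 1.3 (arXiv:2102.11798 chunk p0004 L4–L11)] -/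
def thm13_nonvanishing_twists : Prop :=
  ∀ (W : WeierstrassCurve ℚ) [W.IsElliptic] [W.IsGloballyMinimal] [NeZero (W.conductorNorm ℤ)]
    (Dt : ModularParametrizationData W (W.conductorNorm ℤ)), IsOptimalDatum W Dt →
    Nat.card {P : W.toAffine.Point // (2 : ℕ) • P = 0} ≤ 2 →
    (∃ x : ℚ, W.entireLFunction 1 = (x : ℂ) * (W.realPeriodRat : ℂ) ∧ x ≠ 0 ∧
      padicValRat 2 x =
        -(padicValInt 2 ((Nat.card {P : W.toAffine.Point // (2 : ℕ) • P = 0} : ℤ) * Dt.c))) →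
    {q : ℕ | InS W q}.Infinite →
    ∀ r : ℕ, 1 ≤ r →
      {M : ℤ | Squarefree M ∧ M.natAbs.primeFactors.card = r ∧
          (∀ q ∈ M.natAbs.primeFactors, InS W q) ∧
          ∀ (WM : WeierstrassCurve ℚ) [WM.IsElliptic] [WM.IsGloballyMinimal],
            (∃ C : VariableChange ℚ, C • W.quadraticTwist (M : ℚ) = WM) →
              WM.entireLFunction 1 ≠ 0}.Infinite

/-- **Zhai 2021, Theorem 5.2** (verbatim in the module docstring). `E/ℚ` optimal of conductor `C`
(globally minimal `W`, datum `Dt` with the lattice equality) with `Δ_E < 0`, `E(ℚ)[2] ≅ ℤ/2ℤ`, odd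
Manin constant and `ord₂(L(E,1)/c_∞(E)) = −1`; `M` square-free, `M ≡ 1 (mod 4)`, whose prime factors
form a nonempty set `Q ⊆ 𝒮` of size `r`; `WM` a globally minimal model of `E^{(M)}`. Then
`L(E^{(M)},1) ≠ 0`, `ord₂(L(E^{(M)},1)/c_∞(E^{(M)})) = r − 1`, and `E^{(M)}(ℚ)`, `Ш(E^{(M)})` are
finite. AT 2, analytic rank ZERO. No `_holds` expected.
[cite: Zhai2021BSDExactFormulaTwists, Thm. 5.2 (arXiv:2102.11798 chunk p0010 L80–L97)] -/
def thm52_twoAdic_valuation_twists : Prop :=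
  ∀ (W : WeierstrassCurve ℚ) [W.IsElliptic] [W.IsGloballyMinimal] [NeZero (W.conductorNorm ℤ)]
    (Dt : ModularParametrizationData W (W.conductorNorm ℤ)), IsOptimalDatum W Dt →
    W.Δ < 0 → Nat.card {P : W.toAffine.Point // (2 : ℕ) • P = 0} = 2 → ¬ (2 : ℤ) ∣ Dt.c →
    (∃ x : ℚ, W.entireLFunction 1 = (x : ℂ) * (W.realPeriodRat : ℂ) ∧ padicValRat 2 x = -1) →
    ∀ (M : ℤ), Squarefree M → M % 4 = 1 → M.natAbs.primeFactors.Nonempty →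
      (∀ q ∈ M.natAbs.primeFactors, InS W q) →
    ∀ (WM : WeierstrassCurve ℚ) [WM.IsElliptic] [WM.IsGloballyMinimal],
      (∃ C : VariableChange ℚ, C • W.quadraticTwist (M : ℚ) = WM) →
        WM.entireLFunction 1 ≠ 0 ∧
        (∃ x : ℚ, WM.entireLFunction 1 = (x : ℂ) * (WM.realPeriodRat : ℂ) ∧
          padicValRat 2 x = (M.natAbs.primeFactors.card : ℤ) - 1) ∧
        Finite WM.toAffine.Point ∧ Finite WM.sha

/-! ### §3. Bookkeeping (proved) -/

/-- `t_E(M)` is at most the number of prime factors of `M`. [cite: Zhai2021BSDExactFormulaTwists, §1 (chunk p0003 L11–L21)] -/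
theorem tCount_le_card_primeFactors (WM : WeierstrassCurve ℚ) (M : ℤ) :
    tCount WM M ≤ M.natAbs.primeFactors.card :=
  Finset.card_filter_le _ _

/-- With an odd Manin constant the lower bound of Thm. 1.1 reads `ord₂ ≥ t_E(M) − 1` ("if we assume
`ν_E` is odd, the theorem gives the lower bound `t_E(M) − 1`").
[cite: Zhai2021BSDExactFormulaTwists, §1 (chunk p0003 L34)] -/
theorem padicValInt_two_eq_zero_of_odd {c : ℤ} (hc : ¬ (2 : ℤ) ∣ c) : padicValInt 2 c = 0 :=
  padicValInt.eq_zero_of_not_dvd hc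

end Literature.NumberTheory.EllipticCurves.Zhai2021

end
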